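import Literature.AlgebraicGeometry.Modules.GrothendieckComplexOfProper
import HarnessLib

/-!
# `H⁰` of a quasi-coherent module commutes with FLAT affine base change, in the module Čech dialect
# (The Stacks Project, Tag 02KH in degree `0`; EGA III 1.4.15; Görtz–Wedhorn II, Prop. 22.90)

Topic `AlgebraicGeometry/Modules`; namespace `Literature.AlgebraicGeometry.Modules`; a *proofs* file (theorems only; no
definition, no named fact, no instance, no notation).  For a cartesian square `k ≫ g = g' ≫ j` over an affine
`j : B' → B` with `B`, `B'` affine and `j♯ : Γ(B, 𝒪) → Γ(B', 𝒪)` FLAT (a localisation `A → A_g`, `A → A_𝔭`, a field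
extension …), a finite family `𝓤` of opens of `X` covering `X` with affine non-empty finite intersections and an
affine-localizing (quasi-coherent) `𝒪_X`-module `G`:

* `Modules.range_kerSubtype_baseChange_eq_ker_of_flat` — flatness: `B' ⊗ ker d ↪ B' ⊗ C⁰` with range `ker(d ⊗ B')`
  (Mathlib `Module.Flat.lTensor_exact`);
* **`Modules.exists_tensor_secMod_top_linearEquiv_of_flat`** — a `Γ(B', 𝒪)`-linear isomorphism
  `E : Γ(B') ⊗_{Γ(B)} Γ(X, G) ≃ Γ(X', k^*G)` with `E (b ⊗ t) = b · η(t)` (`η(t)` the pulled-back global section): FLAT BASE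
  CHANGE OF `H⁰` for quasi-coherent modules, the module form of ★ `Morphisms/SectionsFlatBaseChange` (structure sheaf), via
  the natural `H⁰`-representation ★ `Modules/GrothendieckComplexOfProper.exists_secMod_top_linearEquiv_ker_baseChange`;
* **`Modules.span_unitSectionLE_top_eq_top_of_flat`** — in particular `Γ(X', k^*G)` is spanned over `Γ(B', 𝒪)` by the
  `η(t)`, `t ∈ Γ(X, G)` (the spreading step «a section over `X_{A_𝔭}` comes from `Γ(X, G) ⊗ A_𝔭`» of cohomology-and-base-change
  arguments near a point).

Everything is proved; no named facts.  Universe `Scheme.{0}`.  Mathlib searched (pin): `Module.Flat.lTensor_exact`,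
`Module.Flat.lTensor_preserves_injective_linearMap`, `LinearMap.exact_subtype_ker_map`, `LinearMap.baseChange_eq_ltensor`,
`LinearEquiv.ofBijective` (used).  Cell `hodgecm-mathlib`, F-DAG (h2) geometric glue (B-p19 (g14)); generic, count-neutral,
books 0.

## References

* The Stacks Project, Tag 02KH (Cohomology of Schemes, Lemma 30.5.2, flat base change), degree `0`. [StacksProject]
* A. Grothendieck, J. Dieudonné, EGA III₁ (Publ. Math. IHÉS 11, 1961), Prop. (1.4.15). [EGAIII1]
* U. Görtz, T. Wedhorn, *Algebraic Geometry II: Cohomology of Schemes* (2023), Prop. 22.90 (p. 277), proof; Cor. 22.91.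
  [GortzWedhorn2023]
-/

noncomputable section

set_option backward.isDefEq.respectTransparency false

open CategoryTheory CategoryTheory.Limits Opposite TopologicalSpace AlgebraicGeometry TensorProduct
open Literature.Algebra.Homology

namespace Literature.AlgebraicGeometry.Modules

/-! ## §1 Flatness: `B' ⊗ ker d ⥲ ker (d ⊗ B')` -/

/-- **Kernels commute with flat base change**: for `B'` flat over `R`, `B' ⊗ ker d → B' ⊗ M` is injective with range
`ker (d ⊗ B')`. [cite: StacksProject, Tag 02KH] -/
theorem range_kerSubtype_baseChange_eq_ker_of_flat {R : Type*} [CommRing R] {M N : Type*} [AddCommGroup M] [Module R M]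
    [AddCommGroup N] [Module R N] (d : M →ₗ[R] N) (B' : Type*) [CommRing B'] [Algebra R B'] [Module.Flat R B'] :
    Function.Injective ((LinearMap.ker d).subtype.baseChange B') ∧
      LinearMap.range ((LinearMap.ker d).subtype.baseChange B') = LinearMap.ker (d.baseChange B') := by
  refine ⟨?_, ?_⟩
  · have h := Module.Flat.lTensor_preserves_injective_linearMap (M := B') (LinearMap.ker d).subtype
      Subtype.val_injective
    intro x y hxy
    apply h
    rw [← LinearMap.baseChange_eq_ltensor]
    exact hxy
  · have h := Module.Flat.lTensor_exact B' (LinearMap.exact_subtype_ker_map d)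
    have h' : Function.Exact ((LinearMap.ker d).subtype.baseChange B') (d.baseChange B') := by
      rw [LinearMap.exact_iff] at h ⊢
      ext x
      rw [LinearMap.mem_ker, LinearMap.mem_range]
      have := SetLike.ext_iff.mp h x
      rw [LinearMap.mem_ker, LinearMap.mem_range] at this
      simpa only [LinearMap.baseChange_eq_ltensor] using this
    exact (LinearMap.exact_iff.mp h').symm

/-! ## §2 Flat affine base change of global sections -/

section Flat

variable {X B X' B' : Scheme.{0}} {g : X ⟶ B} {g' : X' ⟶ B'} {k : X' ⟶ X} {j : B' ⟶ B}
  [IsAffine B] [IsAffine B'] (H : IsPullback k g' g j)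
  {ι : Type} [LinearOrder ι] [Fintype ι] (U : ι → X.Opens) (hcov : ⨆ i, U i = ⊤)
  (hUa : ∀ s : Finset ι, s.Nonempty → IsAffineOpen (cechOpen U s)) (G : X.Modules)

include H hcov hUa in
/-- **Flat base change of `H⁰` for quasi-coherent modules** (Stacks 02KH, degree `0`; EGA III 1.4.15): for a cartesian square
over an affine `j : B' → B` with `j♯` flat, `Γ(B') ⊗_{Γ(B)} Γ(X, G) ≃ Γ(X', k^*G)`, `b ⊗ t ↦ b · η(t)`.
[cite: StacksProject, Tag 02KH] [cite: EGAIII1, Prop. (1.4.15)] [cite: GortzWedhorn2023, Prop. 22.90 (p. 277), proof] -/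
theorem exists_tensor_secMod_top_linearEquiv_of_flat (hG : IsAffineLocalizing G)
    (hflat : (j.appLE ⊤ ⊤ le_top).hom.Flat) :
    letI := (j.appLE ⊤ ⊤ le_top).hom.toAlgebra
    ∃ E : Γ(B', ⊤) ⊗[Γ(B, ⊤)] SecMod G g.appTop.hom ⊤ ≃ₗ[Γ(B', ⊤)]
        SecMod ((Scheme.Modules.pullback k).obj G) g'.appTop.hom ⊤,
      ∀ (b : Γ(B', ⊤)) (t : SecMod G g.appTop.hom ⊤),
        E (b ⊗ₜ t) = b • SecMod.mk (ρ := g'.appTop.hom) (unitSectionLE k G (V := ⊤) (U := ⊤) le_top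
          (SecMod.val (L := G) (ρ := g.appTop.hom) t)) := by
  letI := (j.appLE ⊤ ⊤ le_top).hom.toAlgebra
  haveI : Module.Flat Γ(B, ⊤) Γ(B', ⊤) := hflat
  let ρ : Γ(B, ⊤) →+* Γ(X, ⊤) := g.appTop.hom
  let ρ' : Γ(B', ⊤) →+* Γ(X', ⊤) := g'.appTop.hom
  let d := OrderedCech.sysD (sectionsSystem U G ρ) 0
  obtain ⟨e', he'⟩ := exists_secMod_top_linearEquiv_ker_baseChange H U hUa G hcov hG
  obtain ⟨hinj, hrange⟩ := range_kerSubtype_baseChange_eq_ker_of_flat d Γ(B', ⊤)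
  -- `Γ(B') ⊗ Γ(X, G) ≃ Γ(B') ⊗ ker d⁰ ≃ ker(d⁰ ⊗ Γ(B')) ≃ Γ(X', k^*G)`
  let E₁ : Γ(B', ⊤) ⊗[Γ(B, ⊤)] SecMod G ρ ⊤ ≃ₗ[Γ(B', ⊤)] Γ(B', ⊤) ⊗[Γ(B, ⊤)] LinearMap.ker d :=
    (kerDZeroEquiv U G ρ hcov).baseChange Γ(B, ⊤) Γ(B', ⊤) _ _
  let E₂ : Γ(B', ⊤) ⊗[Γ(B, ⊤)] LinearMap.ker d ≃ₗ[Γ(B', ⊤)] LinearMap.ker (d.baseChange Γ(B', ⊤)) :=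
    LinearEquiv.ofBijective (((LinearMap.ker d).subtype.baseChange Γ(B', ⊤)).codRestrict _ fun y =>
        hrange.le ⟨y, rfl⟩)
      ⟨fun x y hxy => hinj (congrArg Subtype.val hxy), fun z => by
        obtain ⟨y, hy⟩ := hrange.ge z.2
        exact ⟨y, Subtype.ext hy⟩⟩
  have hE₂ : ∀ y, ((E₂ y : LinearMap.ker (d.baseChange Γ(B', ⊤))) : Γ(B', ⊤) ⊗[Γ(B, ⊤)] OrderedCech.SysCochain
      (sectionsSystem U G ρ) 0) = ((LinearMap.ker d).subtype.baseChange Γ(B', ⊤)) y := fun _ => rfl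
  refine ⟨E₁.trans (E₂.trans e'.symm), fun b t => ?_⟩
  rw [LinearEquiv.trans_apply, LinearEquiv.trans_apply, LinearEquiv.symm_apply_eq]
  apply Subtype.ext
  rw [hE₂, map_smul, Submodule.coe_smul, he', TensorProduct.smul_tmul', smul_eq_mul, mul_one]
  change ((LinearMap.ker d).subtype.baseChange Γ(B', ⊤)) ((kerDZeroEquiv U G ρ hcov).baseChange Γ(B, ⊤) Γ(B', ⊤) _ _
    (b ⊗ₜ t)) = _
  rw [LinearEquiv.baseChange_tmul, LinearMap.baseChange_tmul, Submodule.subtype_apply]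

include H hcov hUa in
/-- **The pulled-back global sections span after a FLAT affine base change**: `Γ(X', k^*G)` is generated over `Γ(B', 𝒪)` by
the `η(t)`, `t ∈ Γ(X, G)` (e.g. `B' = Spec A_𝔭 → B = Spec A`: every section over `X_{A_𝔭}` is `Σ aᵢ/sᵢ · η(tᵢ)`, hence a unit
multiple of a section defined over some `D(s)`). [cite: StacksProject, Tag 02KH] [cite: GortzWedhorn2023, Prop. 22.90 (p. 277), proof] -/
theorem span_unitSectionLE_top_eq_top_of_flat (hG : IsAffineLocalizing G) (hflat : (j.appLE ⊤ ⊤ le_top).hom.Flat) :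
    letI := (j.appLE ⊤ ⊤ le_top).hom.toAlgebra
    Submodule.span Γ(B', ⊤) (Set.range fun t : SecMod G g.appTop.hom ⊤ =>
      SecMod.mk (ρ := g'.appTop.hom) (unitSectionLE k G (V := ⊤) (U := ⊤) le_top
        (SecMod.val (L := G) (ρ := g.appTop.hom) t))) = ⊤ := by
  letI := (j.appLE ⊤ ⊤ le_top).hom.toAlgebra
  obtain ⟨E, hE⟩ := exists_tensor_secMod_top_linearEquiv_of_flat H U hcov hUa G hG hflat
  rw [eq_top_iff]
  rintro t' -
  obtain ⟨y, rfl⟩ := E.surjective t'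
  induction y using TensorProduct.induction_on with
  | zero => rw [map_zero]; exact Submodule.zero_mem _
  | tmul b t => rw [hE]; exact Submodule.smul_mem _ _ (Submodule.subset_span ⟨t, rfl⟩)
  | add x y hx hy => rw [map_add]; exact Submodule.add_mem _ hx hy

end Flat

end Literature.AlgebraicGeometry.Modules

end
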